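import Summits.CriticalPhenomena.SAWScalingLimit.Theorems.SAWLoopFugacityFlowIsingBoundaryRatioRadialDefs
import Literature.Analysis.Complex.HalfPlaneDistortion
import Literature.Analysis.Complex.KoebeQuarterProofs
import HarnessLib

/-!
# Koebe distortion along the radial chain of chart points
(line `fk-anchor-transfer`, crux `IsingBoundaryRatio`, stmt-CriticalPhenomena-10650; helper file of the stub
`stub_halfAnnulusRadialCrossingBound`, RSW clause (iii))

The analytic input of the bulk RSW chain behind the radial crossing lower bound. For `f` holomorphic and
injective on the open upper half-plane `ℍₒ` and `w ∈ ℍₒ` put `r(w) = im w · |f'(w)| / 32`. Then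

* `ball_koebeRadius_subset` — `B(f(w), r(w)) ⊆ f(B(w, im w / 8))` (Koebe's one-quarter theorem,
  `Literature.Analysis.Complex.koebeQuarter_holds`, on the disc `B(w, im w/8) ⊆ ℍₒ`), so the points of
  `B(f w, r w)` have chart preimages of norm in `(7‖w‖/8, 9‖w‖/8)` (`norm_bounds_of_mem_ball_eighth`);
* `norm_sub_le_koebeRadius` — `|f(w') - f(w)| ≤ r(w)/8` for `|w' - w| ≤ im w / 1024` (Koebe growth,
  `norm_sub_le_four_mul`);
* `koebeRadius_le_mul` — `r(w') ≤ 32 r(w)` and `r(w) ≤ 32 r(w')` for `|w' - w| ≤ im w/2`, `im w ≤ im w' ≤ 2 im w`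
  (Koebe distortion, `distortion_upperHalfPlane`);
* the chain of chart points `chainPt ρ j = i · (3/4) ρ q^j`, `q = 1025/1024`, `j ≤ K(M) = kSteps M` (the least
  `K` with `q^K ≥ 2M`): norms, increments `|w_{j+1} - w_j| = im w_j / 1024`, and the comparison of all the radii
  `r(w_j)` with `r(w_0)` within the factor `32^j` (`koebeRadius_chain_bounds`).
[folklore]
-/

noncomputable section

open scoped Classical Topology
open Set Metric Filter Complex
open UpperHalfPlane (upperHalfPlaneSet)

namespace Summit.CriticalPhenomena.SAWScalingLimit.Theorems.IsingBoundaryRatio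

namespace RadialChain

/-! ### Koebe on the disc `B(w, im w / 8)` -/

section Koebe

variable {f : ℂ → ℂ}

/-- The Koebe radius `r(w) = im w · |f'(w)| / 32` of the chart point `w`. [folklore] -/
def koebeRadius (f : ℂ → ℂ) (w : ℂ) : ℝ := w.im * ‖deriv f w‖ / 32

/-- The disc `B(w, im w / 8)` lies in the open upper half-plane. [folklore] -/
theorem ball_eighth_subset_upperHalfPlaneSet {w : ℂ} (hw : 0 < w.im) : ball w (w.im / 8) ⊆ upperHalfPlaneSet :=
  (ball_subset_ball (by linarith)).trans (Literature.Analysis.Complex.AreaThm.ball_im_subset_upperHalfPlaneSet w)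

/-- The Koebe radius is positive at a point of `ℍₒ` (the derivative of an injective holomorphic map does not
vanish). [folklore] -/
theorem koebeRadius_pos (hf : DifferentiableOn ℂ f upperHalfPlaneSet) (hinj : InjOn f upperHalfPlaneSet)
    {w : ℂ} (hw : 0 < w.im) : 0 < koebeRadius f w := by
  have hd : deriv f w ≠ 0 :=
    Literature.Analysis.Complex.SCV.deriv_ne_zero_of_injOn hf UpperHalfPlane.isOpen_upperHalfPlaneSet hinj hw
  unfold koebeRadius
  have := norm_pos_iff.2 hd
  positivity

/-- **Koebe's one-quarter theorem on `B(w, im w / 8)`**: `B(f(w), r(w)) ⊆ f(B(w, im w / 8))`.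
[cite: Lawler2008, Thm. 3.17 (p. 62)] -/
theorem ball_koebeRadius_subset (hf : DifferentiableOn ℂ f upperHalfPlaneSet) (hinj : InjOn f upperHalfPlaneSet)
    {w : ℂ} (hw : 0 < w.im) : ball (f w) (koebeRadius f w) ⊆ f '' ball w (w.im / 8) := by
  have hR : 0 < w.im / 8 := by positivity
  have hsub := ball_eighth_subset_upperHalfPlaneSet hw
  obtain ⟨hFd, hFinj, hFderiv⟩ := Literature.Analysis.Complex.AreaThm.rescale_ball hR (hf.mono hsub) (hinj.mono hsub)
  have hK := Literature.Analysis.Complex.koebeQuarter_holds _ hFd hFinj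
  have h0 : deriv (fun ζ ↦ f (w + (w.im / 8 : ℝ) * ζ)) 0 = (w.im / 8 : ℝ) * deriv f w := by
    have := hFderiv 0 (mem_ball_self one_pos); simpa using this
  simp only [mul_zero, add_zero, h0, norm_mul, Complex.norm_real, Real.norm_eq_abs, abs_of_pos hR] at hK
  have hr : koebeRadius f w = w.im / 8 * ‖deriv f w‖ / 4 := by unfold koebeRadius; ring
  rw [hr]
  refine hK.trans ?_
  rintro _ ⟨ζ, hζ, rfl⟩
  refine ⟨w + (w.im / 8 : ℝ) * ζ, ?_, rfl⟩
  rw [mem_ball, dist_eq_norm, add_sub_cancel_left, norm_mul, Complex.norm_real, Real.norm_eq_abs, abs_of_pos hR]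
  rw [mem_ball_zero_iff] at hζ
  nlinarith

/-- Points of `B(w, im w / 8)`: norm in `(7‖w‖/8, 9‖w‖/8)`, positive imaginary part, norm `< 2‖w‖`.
[folklore] -/
theorem norm_bounds_of_mem_ball_eighth {w w' : ℂ} (hw : 0 < w.im) (hw' : w' ∈ ball w (w.im / 8)) :
    7 / 8 * ‖w‖ < ‖w'‖ ∧ ‖w'‖ < 9 / 8 * ‖w‖ ∧ 0 < w'.im := by
  rw [mem_ball, dist_eq_norm] at hw'
  have him : w.im ≤ ‖w‖ := by have := Complex.abs_im_le_norm w; rw [abs_of_pos hw] at this; exact this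
  have h1 := norm_sub_norm_le w' w
  have h2 := norm_sub_norm_le w w'
  rw [norm_sub_rev] at h2
  refine ⟨by linarith, by linarith, ball_eighth_subset_upperHalfPlaneSet hw (by rw [mem_ball, dist_eq_norm]; exact hw')⟩

/-- **Points of `B(f w, r(w))` are images of chart points of norm in `(7‖w‖/8, 9‖w‖/8)` in `ℍₒ`.** [folklore] -/
theorem exists_preimage_of_mem_ball_koebeRadius (hf : DifferentiableOn ℂ f upperHalfPlaneSet)
    (hinj : InjOn f upperHalfPlaneSet) {w : ℂ} (hw : 0 < w.im) {z : ℂ} (hz : z ∈ ball (f w) (koebeRadius f w)) :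
    ∃ w' : ℂ, 0 < w'.im ∧ f w' = z ∧ 7 / 8 * ‖w‖ < ‖w'‖ ∧ ‖w'‖ < 9 / 8 * ‖w‖ ∧ ‖w' - w‖ < w.im / 8 := by
  obtain ⟨w', hw', rfl⟩ := ball_koebeRadius_subset hf hinj hw hz
  obtain ⟨h1, h2, h3⟩ := norm_bounds_of_mem_ball_eighth hw hw'
  rw [mem_ball, dist_eq_norm] at hw'
  exact ⟨w', h3, rfl, h1, h2, hw'⟩

/-- **Koebe growth**: `|f(w') - f(w)| ≤ r(w)/8` for `|w' - w| ≤ im w / 1024`. [cite: PommerenkeBBCM1992, Thm. 1.3] -/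
theorem norm_sub_le_koebeRadius (hf : DifferentiableOn ℂ f upperHalfPlaneSet) (hinj : InjOn f upperHalfPlaneSet)
    {w w' : ℂ} (hw : 0 < w.im) (hw' : ‖w' - w‖ ≤ w.im / 1024) : ‖f w' - f w‖ ≤ koebeRadius f w / 8 := by
  have h := Literature.Analysis.Complex.AreaThm.norm_sub_le_four_mul hf hinj hw (hw'.trans (by linarith))
  have hd : 0 ≤ ‖deriv f w‖ := norm_nonneg _
  calc ‖f w' - f w‖ ≤ 4 * ‖deriv f w‖ * ‖w' - w‖ := h
    _ ≤ 4 * ‖deriv f w‖ * (w.im / 1024) := by gcongr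
    _ = koebeRadius f w / 8 := by unfold koebeRadius; ring

/-- **Koebe distortion of the radii**: for `|w' - w| ≤ im w / 2` and `im w ≤ im w' ≤ 2 im w`,
`r(w') ≤ 32 r(w)` and `r(w) ≤ 32 r(w')`. [cite: PommerenkeBBCM1992, Thm. 1.3] -/
theorem koebeRadius_le_mul (hf : DifferentiableOn ℂ f upperHalfPlaneSet) (hinj : InjOn f upperHalfPlaneSet)
    {w w' : ℂ} (hw : 0 < w.im) (hw' : ‖w' - w‖ ≤ w.im / 2) (h1 : w.im ≤ w'.im) (h2 : w'.im ≤ 2 * w.im) :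
    koebeRadius f w' ≤ 32 * koebeRadius f w ∧ koebeRadius f w ≤ 32 * koebeRadius f w' := by
  obtain ⟨hd1, hd2, -⟩ := Literature.Analysis.Complex.AreaThm.distortion_upperHalfPlane hf hinj hw hw'
  have hd : 0 ≤ ‖deriv f w‖ := norm_nonneg _
  have hd' : 0 ≤ ‖deriv f w'‖ := norm_nonneg _
  unfold koebeRadius
  constructor
  · calc w'.im * ‖deriv f w'‖ / 32 ≤ (2 * w.im) * (12 * ‖deriv f w‖) / 32 := by gcongr
      _ ≤ 32 * (w.im * ‖deriv f w‖ / 32) := by nlinarith [mul_nonneg hw.le hd]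
  · have h27 : ‖deriv f w‖ ≤ 27 / 4 * ‖deriv f w'‖ := by linarith
    have hw'0 : 0 ≤ w'.im := hw.le.trans h1
    calc w.im * ‖deriv f w‖ / 32 ≤ w'.im * (27 / 4 * ‖deriv f w'‖) / 32 := by gcongr
      _ ≤ 32 * (w'.im * ‖deriv f w'‖ / 32) := by nlinarith [mul_nonneg (hw.le.trans h1) hd']

end Koebe

/-! ### The chain of chart points -/

section Chain

/-- The ratio `q = 1025/1024` of consecutive chart radii. [folklore] -/
def qRatio : ℝ := 1025 / 1024

/-- `q > 1`. [folklore] -/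
theorem one_lt_qRatio : 1 < qRatio := by unfold qRatio; norm_num

/-- `q > 0`. [folklore] -/
theorem qRatio_pos : 0 < qRatio := one_pos.trans one_lt_qRatio

/-- `q - 1 = 1/1024`. [folklore] -/
theorem qRatio_sub_one : qRatio - 1 = 1 / 1024 := by unfold qRatio; norm_num

/-- There is a power of `q` above `2M`. [folklore] -/
theorem exists_pow_qRatio_ge (M : ℝ) : ∃ K : ℕ, 2 * M ≤ qRatio ^ K := by
  obtain ⟨K, hK⟩ := pow_unbounded_of_one_lt (2 * M) one_lt_qRatio
  exact ⟨K, hK.le⟩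

/-- The number of steps `K(M)`: the least `K` with `q^K ≥ 2M`. [folklore] -/
def kSteps (M : ℝ) : ℕ := Nat.find (exists_pow_qRatio_ge M)

/-- `2M ≤ q ^ K(M)`. [folklore] -/
theorem le_qRatio_pow_kSteps (M : ℝ) : 2 * M ≤ qRatio ^ kSteps M := Nat.find_spec (exists_pow_qRatio_ge M)

/-- For `M > 1`: `1 ≤ K(M)` and `q ^ K(M) < 2 M q`. [folklore] -/
theorem kSteps_spec {M : ℝ} (hM : 1 < M) : 1 ≤ kSteps M ∧ qRatio ^ kSteps M < 2 * M * qRatio := by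
  have h0 : ¬ (2 * M ≤ qRatio ^ 0) := by rw [pow_zero]; linarith
  have hK0 : kSteps M ≠ 0 := fun h => by
    have := le_qRatio_pow_kSteps M; rw [h] at this; exact h0 this
  have hK1 : 1 ≤ kSteps M := Nat.one_le_iff_ne_zero.2 hK0
  refine ⟨hK1, ?_⟩
  have hlt : kSteps M - 1 < kSteps M := by omega
  have hmin : ¬ (2 * M ≤ qRatio ^ (kSteps M - 1)) := Nat.find_min (exists_pow_qRatio_ge M) hlt
  rw [not_le] at hmin
  have : qRatio ^ kSteps M = qRatio ^ (kSteps M - 1) * qRatio := by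
    rw [← pow_succ]; congr 1; omega
  rw [this]
  exact mul_lt_mul_of_pos_right hmin qRatio_pos

/-- The `j`-th chart point of the radial chain at scale `ρ`: `w_j = i · (3/4) ρ q^j`. [folklore] -/
def chainPt (ρ : ℝ) (j : ℕ) : ℂ := Complex.I * ((3 / 4 * ρ * qRatio ^ j : ℝ) : ℂ)

/-- Real and imaginary parts and norm of the chart points. [folklore] -/
theorem chainPt_im (ρ : ℝ) (j : ℕ) : (chainPt ρ j).im = 3 / 4 * ρ * qRatio ^ j := by
  rw [chainPt, Complex.mul_im, Complex.I_re, Complex.I_im, Complex.ofReal_re, Complex.ofReal_im]; ring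

/-- The chart points are purely imaginary. [folklore] -/
theorem chainPt_re (ρ : ℝ) (j : ℕ) : (chainPt ρ j).re = 0 := by
  rw [chainPt, Complex.mul_re, Complex.I_re, Complex.I_im, Complex.ofReal_re, Complex.ofReal_im]; ring

/-- Norm of the chart points. [folklore] -/
theorem norm_chainPt {ρ : ℝ} (hρ : 0 < ρ) (j : ℕ) : ‖chainPt ρ j‖ = 3 / 4 * ρ * qRatio ^ j := by
  have h : 0 < 3 / 4 * ρ * qRatio ^ j := by have := pow_pos qRatio_pos j; positivity
  rw [chainPt, norm_mul, Complex.norm_I, one_mul, Complex.norm_real, Real.norm_eq_abs, abs_of_pos h]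

/-- The chart points lie in the open upper half-plane. [folklore] -/
theorem chainPt_im_pos {ρ : ℝ} (hρ : 0 < ρ) (j : ℕ) : 0 < (chainPt ρ j).im := by
  rw [chainPt_im]; have := pow_pos qRatio_pos j; positivity

/-- Norm and imaginary part of the chart points agree. [folklore] -/
theorem norm_chainPt_eq_im {ρ : ℝ} (hρ : 0 < ρ) (j : ℕ) : ‖chainPt ρ j‖ = (chainPt ρ j).im := by
  rw [norm_chainPt hρ, chainPt_im]

/-- Consecutive chart points: `w_{j+1} - w_j` has norm `im w_j / 1024`, and `im w_j ≤ im w_{j+1} ≤ 2 im w_j`.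
[folklore] -/
theorem chainPt_succ {ρ : ℝ} (hρ : 0 < ρ) (j : ℕ) :
    ‖chainPt ρ (j + 1) - chainPt ρ j‖ = (chainPt ρ j).im / 1024 ∧
      (chainPt ρ j).im ≤ (chainPt ρ (j + 1)).im ∧ (chainPt ρ (j + 1)).im ≤ 2 * (chainPt ρ j).im := by
  have hqj := pow_pos qRatio_pos j
  have h : 0 < 3 / 4 * ρ * qRatio ^ j := by positivity
  refine ⟨?_, ?_, ?_⟩
  · have : chainPt ρ (j + 1) - chainPt ρ j = Complex.I * ((3 / 4 * ρ * qRatio ^ j * (qRatio - 1) : ℝ) : ℂ) := by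
      simp only [chainPt, pow_succ]; push_cast; ring
    rw [this, norm_mul, Complex.norm_I, one_mul, Complex.norm_real, Real.norm_eq_abs, qRatio_sub_one,
      abs_of_pos (by positivity), chainPt_im]
    ring
  · rw [chainPt_im, chainPt_im, pow_succ]
    have := one_lt_qRatio
    nlinarith
  · rw [chainPt_im, chainPt_im, pow_succ]
    have : qRatio ≤ 2 := by unfold qRatio; norm_num
    nlinarith

/-- Norms along the chain: `(3/4) ρ ≤ ‖w_j‖`, and `‖w_j‖ < (3/2) M q ρ` for `j ≤ K(M)`, `M > 1`; the end
points: `‖w_0‖ = (3/4) ρ`, `(3/2) M ρ ≤ ‖w_K‖`. [folklore] -/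
theorem norm_chainPt_bounds {ρ M : ℝ} (hρ : 0 < ρ) (hM : 1 < M) {j : ℕ} (hj : j ≤ kSteps M) :
    3 / 4 * ρ ≤ ‖chainPt ρ j‖ ∧ ‖chainPt ρ j‖ < 3 / 2 * M * qRatio * ρ ∧
      ‖chainPt ρ 0‖ = 3 / 4 * ρ ∧ 3 / 2 * M * ρ ≤ ‖chainPt ρ (kSteps M)‖ := by
  obtain ⟨-, hK⟩ := kSteps_spec hM
  have hq1 := one_lt_qRatio
  rw [norm_chainPt hρ, norm_chainPt hρ, norm_chainPt hρ, pow_zero, mul_one]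
  have h1 : 1 ≤ qRatio ^ j := one_le_pow₀ hq1.le
  have h2 : qRatio ^ j ≤ qRatio ^ kSteps M := pow_le_pow_right₀ hq1.le hj
  have h3 := le_qRatio_pow_kSteps M
  refine ⟨by nlinarith, ?_, rfl, by nlinarith⟩
  calc 3 / 4 * ρ * qRatio ^ j ≤ 3 / 4 * ρ * qRatio ^ kSteps M := by gcongr
    _ < 3 / 4 * ρ * (2 * M * qRatio) := by gcongr
    _ = 3 / 2 * M * qRatio * ρ := by ring

/-- **Comparison of the Koebe radii along the chain**: `r(w_j) ≤ 32^j r(w_0)` and `r(w_0) ≤ 32^j r(w_j)`.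
[folklore] -/
theorem koebeRadius_chain_bounds {f : ℂ → ℂ} (hf : DifferentiableOn ℂ f upperHalfPlaneSet)
    (hinj : InjOn f upperHalfPlaneSet) {ρ : ℝ} (hρ : 0 < ρ) :
    ∀ j : ℕ, koebeRadius f (chainPt ρ j) ≤ 32 ^ j * koebeRadius f (chainPt ρ 0) ∧
      koebeRadius f (chainPt ρ 0) ≤ 32 ^ j * koebeRadius f (chainPt ρ j)
  | 0 => by simp
  | j + 1 => by
    obtain ⟨ih1, ih2⟩ := koebeRadius_chain_bounds hf hinj hρ j
    obtain ⟨hn, him1, him2⟩ := chainPt_succ hρ j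
    have hw := chainPt_im_pos hρ j
    obtain ⟨h1, h2⟩ := koebeRadius_le_mul hf hinj hw (by rw [hn]; linarith) him1 him2
    have h32 : (0 : ℝ) ≤ 32 ^ j := by positivity
    constructor
    · calc koebeRadius f (chainPt ρ (j + 1)) ≤ 32 * koebeRadius f (chainPt ρ j) := h1
        _ ≤ 32 * (32 ^ j * koebeRadius f (chainPt ρ 0)) := by gcongr
        _ = 32 ^ (j + 1) * koebeRadius f (chainPt ρ 0) := by ring
    · calc koebeRadius f (chainPt ρ 0) ≤ 32 ^ j * koebeRadius f (chainPt ρ j) := ih2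
        _ ≤ 32 ^ j * (32 * koebeRadius f (chainPt ρ (j + 1))) := by gcongr
        _ = 32 ^ (j + 1) * koebeRadius f (chainPt ρ (j + 1)) := by ring

/-- **Consecutive centres are close**: `|f(w_{j+1}) - f(w_j)| ≤ r(w_j)/8`. [folklore] -/
theorem norm_apply_chainPt_succ_sub_le {f : ℂ → ℂ} (hf : DifferentiableOn ℂ f upperHalfPlaneSet)
    (hinj : InjOn f upperHalfPlaneSet) {ρ : ℝ} (hρ : 0 < ρ) (j : ℕ) :
    ‖f (chainPt ρ (j + 1)) - f (chainPt ρ j)‖ ≤ koebeRadius f (chainPt ρ j) / 8 := by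
  obtain ⟨hn, -, -⟩ := chainPt_succ hρ j
  exact norm_sub_le_koebeRadius hf hinj (chainPt_im_pos hρ j) hn.le

/-- **A uniform lower radius**: with `r_lo = r(w_0) / 32^K`, for every `j ≤ K`:
`r_lo ≤ r(w_j) ≤ 1024^K · r_lo`, and `r_lo > 0`. [folklore] -/
theorem koebeRadius_uniform {f : ℂ → ℂ} (hf : DifferentiableOn ℂ f upperHalfPlaneSet)
    (hinj : InjOn f upperHalfPlaneSet) {ρ : ℝ} (hρ : 0 < ρ) (K : ℕ) :
    0 < koebeRadius f (chainPt ρ 0) / 32 ^ K ∧ ∀ j ≤ K,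
      koebeRadius f (chainPt ρ 0) / 32 ^ K ≤ koebeRadius f (chainPt ρ j) ∧
      koebeRadius f (chainPt ρ j) ≤ 1024 ^ K * (koebeRadius f (chainPt ρ 0) / 32 ^ K) := by
  have hr0 := koebeRadius_pos hf hinj (chainPt_im_pos hρ 0)
  have h32K : (0 : ℝ) < 32 ^ K := by positivity
  refine ⟨div_pos hr0 h32K, fun j hj => ?_⟩
  obtain ⟨h1, h2⟩ := koebeRadius_chain_bounds hf hinj hρ j
  have hrj := koebeRadius_pos hf hinj (chainPt_im_pos hρ j)
  have hjK : (32 : ℝ) ^ j ≤ 32 ^ K := pow_le_pow_right₀ (by norm_num) hj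
  constructor
  · rw [div_le_iff₀ h32K]
    calc koebeRadius f (chainPt ρ 0) ≤ 32 ^ j * koebeRadius f (chainPt ρ j) := h2
      _ ≤ 32 ^ K * koebeRadius f (chainPt ρ j) := by gcongr
      _ = koebeRadius f (chainPt ρ j) * 32 ^ K := by ring
  · have h1024 : (1024 : ℝ) ^ K = 32 ^ K * 32 ^ K := by rw [← mul_pow]; norm_num
    rw [h1024, mul_assoc, mul_div_cancel₀ _ h32K.ne']
    calc koebeRadius f (chainPt ρ j) ≤ 32 ^ j * koebeRadius f (chainPt ρ 0) := h1
      _ ≤ 32 ^ K * koebeRadius f (chainPt ρ 0) := by gcongr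

end Chain

end RadialChain

/-- **A uniform lower Koebe radius along the radial chain** (registered sub-goal of stmt-CriticalPhenomena-10650,
clause (iii) helper; closed form of `RadialChain.koebeRadius_uniform`). [folklore] -/
theorem radial_koebeRadius_uniform : ∀ {f : ℂ → ℂ}, DifferentiableOn ℂ f upperHalfPlaneSet → InjOn f upperHalfPlaneSet → ∀ {ρ : ℝ}, 0 < ρ → ∀ (K : ℕ), 0 < RadialChain.koebeRadius f (RadialChain.chainPt ρ 0) / 32 ^ K ∧ ∀ j ≤ K, RadialChain.koebeRadius f (RadialChain.chainPt ρ 0) / 32 ^ K ≤ RadialChain.koebeRadius f (RadialChain.chainPt ρ j) ∧ RadialChain.koebeRadius f (RadialChain.chainPt ρ j) ≤ 1024 ^ K * (RadialChain.koebeRadius f (RadialChain.chainPt ρ 0) / 32 ^ K) :=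
  fun hf hinj _ hρ K => RadialChain.koebeRadius_uniform hf hinj hρ K

end Summit.CriticalPhenomena.SAWScalingLimit.Theorems.IsingBoundaryRatio

end
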